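import Literature.NumberTheory.Rogawski1990.ArchInnerTransferReadInnerFrames     -- ★ (11) part 2 (this seat)
import Literature.NumberTheory.Rogawski1990.ArchWeilDataCongruence              -- ★ (T-d): Weil data pushed along a congruence
import Literature.NumberTheory.Rogawski1990.ArchCompatibleFamilies              -- ★ `ArchCompatibleFamiliesG`
import Literature.NumberTheory.Rogawski1990.ArchInnerTwistChartPartners         -- ★ (3′)
import Literature.NumberTheory.Rogawski1990.ArchSingularStableTransportWallTorus -- ★ `archStableOrbitalIntegral_eq_of_isStablyConj`
import HarnessLib

/-!
# READ-INNER, part 3 (N8-INNER brick (11) «JUNCTION», LH3-p03 (g7)): from the chart identity to the (14.2.1) relation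

Topic `NumberTheory/Rogawski1990`; namespace `Literature.NumberTheory.Rogawski1990`.  THEOREMS ONLY.  Brick (11), LAYER 2 part 3 of 3:
for a compatible Weil-form system `(m′, m, t′, t)` on `(G′_∞ = U(diag α), G_∞ = U(Φ₃))` (★ `ArchCompatibleFamiliesG`) and the quasi-split congruence
`Φ : U(Φ₃)_∞ ≃ₜ* U(diag β)_∞` (`β = (½,1,−½)`), the STABLE matching on `RegG` of every chart
`stableSumG (orbFamGExt L β (ν.map Φ) f) = stableSumG (κ • orbFamGExt L α ν′ a′)` (`κ = ∏_{w definite} 3⁻¹`)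
implies the inner-transfer relation `IsArchInnerTransfer L (diag α) m′ m a′ (f ∘ Φ)` at every regular `γ ∈ G_∞` — exhaustion of the regular classes by the
`β`-atlas through `Φ` (★ (3)), transport of `Φ^st` along `Φ` (★ (T-d)), the Weil form and coherences pushed along `Φ` (★ `ArchWeilDataCongruence`), the frames
identity (★ part 2), the partner dictionary (★ (3)), and the vanishing at charts meeting a definite place (★ (3) + zero label).

References: Rogawski 1990 §14.2 (14.2.1) pp. 232–233, §4.1–4.3; Shelstad 1979 §4.
-/

set_option autoImplicit false

noncomputable section

open MeasureTheory MeasureTheory.Measure NumberField NumberField.InfinitePlace Matrix Complex Topology Finset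
open Literature.MeasureTheory.Group
open scoped MatrixGroups Matrix Classical NNReal ENNReal

namespace Literature.NumberTheory.Rogawski1990

open Literature.NumberTheory.Automorphic Literature.NumberTheory.Automorphic.UnitaryGroup Literature.NumberTheory.Automorphic.ArchCartan

section ReadInner

variable (L : Type) [Field L] [NumberField L] [IsCMField L] (α : Fin 3 → L)
  [MeasurableSpace ↥(arch (↥(maximalRealSubfield L)) L (IsCMField.complexConj L) 3 (Matrix.diagonal α))]
  [BorelSpace ↥(arch (↥(maximalRealSubfield L)) L (IsCMField.complexConj L) 3 (Matrix.diagonal α))]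
  [MeasurableSpace ↥(arch (↥(maximalRealSubfield L)) L (IsCMField.complexConj L) 3
      (Matrix.of fun i j : Fin 3 => if i.val + j.val + 1 = 3 then (1 : L) else 0))]
  [BorelSpace ↥(arch (↥(maximalRealSubfield L)) L (IsCMField.complexConj L) 3
      (Matrix.of fun i j : Fin 3 => if i.val + j.val + 1 = 3 then (1 : L) else 0))]
  [MeasurableSpace ↥(arch (↥(maximalRealSubfield L)) L (IsCMField.complexConj L) 3 (Matrix.diagonal ![(2 : L)⁻¹, 1, -(2 : L)⁻¹]))]
  [BorelSpace ↥(arch (↥(maximalRealSubfield L)) L (IsCMField.complexConj L) 3 (Matrix.diagonal ![(2 : L)⁻¹, 1, -(2 : L)⁻¹]))]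
  (ν' : Measure ↥(arch (↥(maximalRealSubfield L)) L (IsCMField.complexConj L) 3 (Matrix.diagonal α)))
  (ν : Measure ↥(arch (↥(maximalRealSubfield L)) L (IsCMField.complexConj L) 3
      (Matrix.of fun i j : Fin 3 => if i.val + j.val + 1 = 3 then (1 : L) else 0)))
  [ν'.IsHaarMeasure] [ν'.IsMulRightInvariant] [ν.IsHaarMeasure] [ν.IsMulRightInvariant]
  (T : GL (Fin 3) (mixedEmbedding.mixedSpace L))
  (Φ : ↥(arch (↥(maximalRealSubfield L)) L (IsCMField.complexConj L) 3
      (Matrix.of fun i j : Fin 3 => if i.val + j.val + 1 = 3 then (1 : L) else 0)) ≃ₜ*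
        ↥(arch (↥(maximalRealSubfield L)) L (IsCMField.complexConj L) 3 (Matrix.diagonal ![(2 : L)⁻¹, 1, -(2 : L)⁻¹])))
  (hΦ : ∀ g : ↥(arch (↥(maximalRealSubfield L)) L (IsCMField.complexConj L) 3
      (Matrix.of fun i j : Fin 3 => if i.val + j.val + 1 = 3 then (1 : L) else 0)),
    ((Φ g : ↥(arch (↥(maximalRealSubfield L)) L (IsCMField.complexConj L) 3 (Matrix.diagonal ![(2 : L)⁻¹, 1, -(2 : L)⁻¹]))) :
        GL (Fin 3) (mixedEmbedding.mixedSpace L)) =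
      T * (g : GL (Fin 3) (mixedEmbedding.mixedSpace L)) * T⁻¹)
  [(Measure.map Φ ν).IsHaarMeasure] [(Measure.map Φ ν).IsMulRightInvariant]

include hΦ in
/-- **READ-INNER.**  For a compatible Weil-form system on `(U(diag α), U(Φ₃))` and the quasi-split congruence `Φ`, the stable matching of
`orbFamGExt L β (ν.map Φ) f` with `κ • orbFamGExt L α ν′ a′` on the regular set of every chart gives `IsArchInnerTransfer L (diag α) m′ m a′ (f ∘ Φ)`:
at a regular `γ ∈ U(Φ₃)_∞`, conjugate to `Φ⁻¹(gprimeTorus β S c)` (★ exhaustion), (T1) every partner `γ′` is stably conjugate to `gprimeTorus α S c` and the two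
stable orbital integrals are read on the two atlases (★ frames identity, with the Weil data pushed along `Φ`); (T2) if `S` meets a definite place of `α` there is no
partner and the chart sum vanishes (zero label). [cite: Rogawski1990, §14.2 (14.2.1) pp. 232–233; §4.1 (4.1.1) p. 39; §4.3 (4.3.1) pp. 43–44] [cite: Shelstad1979, §4 p. 20, Lemma 4.2 (p. 23)] -/
theorem isArchInnerTransfer_of_stableSumG_eq (hα : ∀ i, α i ≠ 0) (hherm : ∀ i, (IsCMField.complexConj L (α i) : L) = α i)
    (hanis : ∀ x : Fin 3 → L, Literature.AlgebraicGeometry.ShimuraVarieties.hermForm (cmConjRingHom L) (Matrix.diagonal α) x x = 0 → x = 0) :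
    letI : ∀ γ : ↥(arch (↥(maximalRealSubfield L)) L (IsCMField.complexConj L) 3 (Matrix.diagonal α)),
        MeasurableSpace (↥(arch (↥(maximalRealSubfield L)) L (IsCMField.complexConj L) 3 (Matrix.diagonal α)) ⧸
          Subgroup.centralizer ({γ} : Set ↥(arch (↥(maximalRealSubfield L)) L (IsCMField.complexConj L) 3 (Matrix.diagonal α)))) :=
      fun _ => borel _
    haveI : ∀ γ : ↥(arch (↥(maximalRealSubfield L)) L (IsCMField.complexConj L) 3 (Matrix.diagonal α)),
        BorelSpace (↥(arch (↥(maximalRealSubfield L)) L (IsCMField.complexConj L) 3 (Matrix.diagonal α)) ⧸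
          Subgroup.centralizer ({γ} : Set ↥(arch (↥(maximalRealSubfield L)) L (IsCMField.complexConj L) 3 (Matrix.diagonal α)))) :=
      fun _ => ⟨rfl⟩
    letI : ∀ γ : ↥(arch (↥(maximalRealSubfield L)) L (IsCMField.complexConj L) 3
          (Matrix.of fun i j : Fin 3 => if i.val + j.val + 1 = 3 then (1 : L) else 0)),
        MeasurableSpace (↥(arch (↥(maximalRealSubfield L)) L (IsCMField.complexConj L) 3
            (Matrix.of fun i j : Fin 3 => if i.val + j.val + 1 = 3 then (1 : L) else 0)) ⧸
          Subgroup.centralizer ({γ} : Set ↥(arch (↥(maximalRealSubfield L)) L (IsCMField.complexConj L) 3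
            (Matrix.of fun i j : Fin 3 => if i.val + j.val + 1 = 3 then (1 : L) else 0)))) :=
      fun _ => borel _
    haveI : ∀ γ : ↥(arch (↥(maximalRealSubfield L)) L (IsCMField.complexConj L) 3
          (Matrix.of fun i j : Fin 3 => if i.val + j.val + 1 = 3 then (1 : L) else 0)),
        BorelSpace (↥(arch (↥(maximalRealSubfield L)) L (IsCMField.complexConj L) 3
            (Matrix.of fun i j : Fin 3 => if i.val + j.val + 1 = 3 then (1 : L) else 0)) ⧸
          Subgroup.centralizer ({γ} : Set ↥(arch (↥(maximalRealSubfield L)) L (IsCMField.complexConj L) 3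
            (Matrix.of fun i j : Fin 3 => if i.val + j.val + 1 = 3 then (1 : L) else 0)))) :=
      fun _ => ⟨rfl⟩
    ∀ (m' : OrbitalMeasureFamily ↥(arch (↥(maximalRealSubfield L)) L (IsCMField.complexConj L) 3 (Matrix.diagonal α)))
      (m : OrbitalMeasureFamily ↥(arch (↥(maximalRealSubfield L)) L (IsCMField.complexConj L) 3
        (Matrix.of fun i j : Fin 3 => if i.val + j.val + 1 = 3 then (1 : L) else 0)))
      (t' : ∀ γ' : ↥(arch (↥(maximalRealSubfield L)) L (IsCMField.complexConj L) 3 (Matrix.diagonal α)),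
        Measure (Subgroup.centralizer ({γ'} : Set ↥(arch (↥(maximalRealSubfield L)) L (IsCMField.complexConj L) 3 (Matrix.diagonal α)))))
      (t : ∀ γ : ↥(arch (↥(maximalRealSubfield L)) L (IsCMField.complexConj L) 3
          (Matrix.of fun i j : Fin 3 => if i.val + j.val + 1 = 3 then (1 : L) else 0)),
        Measure (Subgroup.centralizer ({γ} : Set ↥(arch (↥(maximalRealSubfield L)) L (IsCMField.complexConj L) 3
          (Matrix.of fun i j : Fin 3 => if i.val + j.val + 1 = 3 then (1 : L) else 0))))),
      ArchCompatibleFamiliesG L (Matrix.diagonal α) ν' ν hanis m' m t' t →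
        ∀ (a' : ↥(arch (↥(maximalRealSubfield L)) L (IsCMField.complexConj L) 3 (Matrix.diagonal α)) → ℂ)
          (f : ↥(arch (↥(maximalRealSubfield L)) L (IsCMField.complexConj L) 3 (Matrix.diagonal ![(2 : L)⁻¹, 1, -(2 : L)⁻¹])) → ℂ),
          ArchSmooth L 3 (Matrix.diagonal α) a' → ArchSmooth L 3 (Matrix.diagonal ![(2 : L)⁻¹, 1, -(2 : L)⁻¹]) f →
            (∀ (S : Finset {w : InfinitePlace L // IsComplex w}) (c : {w : InfinitePlace L // IsComplex w} → Fin 3 → ℝ),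
                c ∈ RegG S →
                  stableSumG (orbFamGExt L ![(2 : L)⁻¹, 1, -(2 : L)⁻¹] (Measure.map Φ ν) f) S c =
                    stableSumG (fun S' c' => (∏ _w ∈ Finset.univ.filter (fun w => ¬ IsIndefiniteAt (slotSign L α) w), (3 : ℂ)⁻¹) *
                      orbFamGExt L α ν' a' S' c') S c) →
              IsArchInnerTransfer L (Matrix.diagonal α) m' m a' (f ∘ Φ) := by
  intro m' m t' t hSys a' f _ _ hEq γ hγ
  -- the Borel σ-algebras on the orbit quotients of the two given frames (print's convention, as in `ArchCompatibleFamiliesG`)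
  letI qα : ∀ γ' : ↥(arch (↥(maximalRealSubfield L)) L (IsCMField.complexConj L) 3 (Matrix.diagonal α)),
      MeasurableSpace (↥(arch (↥(maximalRealSubfield L)) L (IsCMField.complexConj L) 3 (Matrix.diagonal α)) ⧸
        Subgroup.centralizer ({γ'} : Set ↥(arch (↥(maximalRealSubfield L)) L (IsCMField.complexConj L) 3 (Matrix.diagonal α)))) :=
    fun _ => borel _
  haveI : ∀ γ' : ↥(arch (↥(maximalRealSubfield L)) L (IsCMField.complexConj L) 3 (Matrix.diagonal α)),
      BorelSpace (↥(arch (↥(maximalRealSubfield L)) L (IsCMField.complexConj L) 3 (Matrix.diagonal α)) ⧸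
        Subgroup.centralizer ({γ'} : Set ↥(arch (↥(maximalRealSubfield L)) L (IsCMField.complexConj L) 3 (Matrix.diagonal α)))) :=
    fun _ => ⟨rfl⟩
  letI q₂ : ∀ γ₂ : ↥(arch (↥(maximalRealSubfield L)) L (IsCMField.complexConj L) 3
      (Matrix.of fun i j : Fin 3 => if i.val + j.val + 1 = 3 then (1 : L) else 0)),
      MeasurableSpace (↥(arch (↥(maximalRealSubfield L)) L (IsCMField.complexConj L) 3
          (Matrix.of fun i j : Fin 3 => if i.val + j.val + 1 = 3 then (1 : L) else 0)) ⧸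
        Subgroup.centralizer ({γ₂} : Set ↥(arch (↥(maximalRealSubfield L)) L (IsCMField.complexConj L) 3
          (Matrix.of fun i j : Fin 3 => if i.val + j.val + 1 = 3 then (1 : L) else 0)))) :=
    fun _ => borel _
  haveI : ∀ γ₂ : ↥(arch (↥(maximalRealSubfield L)) L (IsCMField.complexConj L) 3
      (Matrix.of fun i j : Fin 3 => if i.val + j.val + 1 = 3 then (1 : L) else 0)),
      BorelSpace (↥(arch (↥(maximalRealSubfield L)) L (IsCMField.complexConj L) 3
          (Matrix.of fun i j : Fin 3 => if i.val + j.val + 1 = 3 then (1 : L) else 0)) ⧸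
        Subgroup.centralizer ({γ₂} : Set ↥(arch (↥(maximalRealSubfield L)) L (IsCMField.complexConj L) 3
          (Matrix.of fun i j : Fin 3 => if i.val + j.val + 1 = 3 then (1 : L) else 0)))) :=
    fun _ => ⟨rfl⟩
  -- frame constants
  have hβ : ∀ i, (![(2 : L)⁻¹, 1, -(2 : L)⁻¹] : Fin 3 → L) i ≠ 0 := quasiSplitWeights_ne_zero L
  have hhermβ : ∀ i, (IsCMField.complexConj L ((![(2 : L)⁻¹, 1, -(2 : L)⁻¹] : Fin 3 → L) i) : L) =
      (![(2 : L)⁻¹, 1, -(2 : L)⁻¹] : Fin 3 → L) i := fun i => cmConjRingHom_quasiSplitWeights L i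
  have hreal : ∀ (w : {w : InfinitePlace L // IsComplex w}) (k : Fin 3), (w.1.embedding (α k)).im = 0 :=
    fun w k => im_embedding_diagonal_eq_zero L 3 α hherm w k
  have hd' : (Matrix.diagonal α).det ≠ 0 := Godement.det_ne_zero_of_anisotropic L (Matrix.diagonal α) hanis
  have hd₂ : (Matrix.of fun i j : Fin 3 => if i.val + j.val + 1 = 3 then (1 : L) else 0).det ≠ 0 :=
    (isUnit_antidiagOne_det L 3).ne_zero
  have hdβ : (Matrix.diagonal ![(2 : L)⁻¹, 1, -(2 : L)⁻¹]).det ≠ 0 := by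
    rw [Matrix.det_diagonal]
    exact Finset.prod_ne_zero_iff.2 fun i _ => hβ i
  obtain ⟨hW', hW, hC', hC, hC'G⟩ := hSys
  -- the Weil data on the quasi-split atlas group, pushed along `Φ`
  letI qβ : ∀ δ : ↥(arch (↥(maximalRealSubfield L)) L (IsCMField.complexConj L) 3 (Matrix.diagonal ![(2 : L)⁻¹, 1, -(2 : L)⁻¹])),
      MeasurableSpace (↥(arch (↥(maximalRealSubfield L)) L (IsCMField.complexConj L) 3 (Matrix.diagonal ![(2 : L)⁻¹, 1, -(2 : L)⁻¹])) ⧸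
        Subgroup.centralizer ({δ} : Set ↥(arch (↥(maximalRealSubfield L)) L (IsCMField.complexConj L) 3 (Matrix.diagonal ![(2 : L)⁻¹, 1, -(2 : L)⁻¹])))) :=
    fun _ => borel _
  haveI : ∀ δ : ↥(arch (↥(maximalRealSubfield L)) L (IsCMField.complexConj L) 3 (Matrix.diagonal ![(2 : L)⁻¹, 1, -(2 : L)⁻¹])),
      BorelSpace (↥(arch (↥(maximalRealSubfield L)) L (IsCMField.complexConj L) 3 (Matrix.diagonal ![(2 : L)⁻¹, 1, -(2 : L)⁻¹])) ⧸
        Subgroup.centralizer ({δ} : Set ↥(arch (↥(maximalRealSubfield L)) L (IsCMField.complexConj L) 3 (Matrix.diagonal ![(2 : L)⁻¹, 1, -(2 : L)⁻¹])))) :=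
    fun _ => ⟨rfl⟩
  obtain ⟨tβ, htβ⟩ := exists_torusPush_archCongr (L := L) (Φ := Φ) (t₂ := t)
  have hWβ := isQuotientOf_transport_archCongr (L := L) (hH₂ := hd₂) (T := T) (Φ := Φ) (hΦ := hΦ)
    (t₂ := t) (t := tβ) (ht := htβ) (hW := hW) (hC₂ := hC) (ν := Measure.map Φ ν) rfl
  have hCβ : ∀ (δ₁ δ₂ : ↥(arch (↥(maximalRealSubfield L)) L (IsCMField.complexConj L) 3 (Matrix.diagonal ![(2 : L)⁻¹, 1, -(2 : L)⁻¹])))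
      (h₁ : IsRegularElt (δ₁.val : GL (Fin 3) (mixedEmbedding.mixedSpace L)))
      (hc : Corresponds (UnitaryGroup.conjMixed (↥(maximalRealSubfield L)) L (IsCMField.complexConj L))
        (UnitaryGroup.archFormOf L 3 (Matrix.diagonal ![(2 : L)⁻¹, 1, -(2 : L)⁻¹]))
        (UnitaryGroup.archFormOf L 3 (Matrix.diagonal ![(2 : L)⁻¹, 1, -(2 : L)⁻¹])) δ₁ δ₂),
      Measure.map ⇑(UnitaryGroup.archStableCentralizerEquiv L hdβ hdβ hc h₁) (tβ δ₁) = tβ δ₂ :=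
    fun δ₁ δ₂ h₁ hc => map_archStableCentralizerEquiv_torusPush_eq (L := L) (hH := hdβ) (hH₂ := hd₂) (T := T) (Φ := Φ) (hΦ := hΦ)
      (t₂ := t) (t := tβ) (ht := htβ) hC δ₁ δ₂ h₁ hc
  -- the regular class of `γ` meets the `β`-atlas through `Φ`
  obtain ⟨S, c, g, hc, hγeq⟩ := exists_conj_archCongr_symm_gprimeTorus_of_isRegularElt (L := L) (T := T) (Φ := Φ) (hΦ := hΦ) γ hγ
  set δ := Φ.symm (gprimeTorus L ![(2 : L)⁻¹, 1, -(2 : L)⁻¹] S c) with hδ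
  have hstγδ : IsStablyConj (UnitaryGroup.conjMixed (↥(maximalRealSubfield L)) L (IsCMField.complexConj L))
      (UnitaryGroup.archFormOf L 3 (Matrix.of fun i j : Fin 3 => if i.val + j.val + 1 = 3 then (1 : L) else 0)) γ δ := by
    exact isStablyConj_of_isConj (isConj_iff.2 ⟨g, hγeq.symm⟩).symm
  -- `Φ^st_m(γ, f ∘ Φ) = Φ^st_{m_β}(gprimeTorus β S c, f)`
  have hLHS : archStableOrbitalIntegral L 3 _ m (f ∘ Φ) γ =
      archStableOrbitalIntegral L 3 (Matrix.diagonal ![(2 : L)⁻¹, 1, -(2 : L)⁻¹])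
        (m.transport Φ.toMulEquiv Φ.continuous Φ.symm.continuous) f (gprimeTorus L ![(2 : L)⁻¹, 1, -(2 : L)⁻¹] S c) := by
    rw [archStableOrbitalIntegral_eq_of_isStablyConj L 3 _ m (f ∘ Φ) hstγδ,
      ← archStableOrbitalIntegral_transport_archCongr L T Φ hΦ m (f ∘ Φ) δ]
    have hf : (f ∘ Φ) ∘ Φ.symm = f := by funext x; simp
    rw [hf, hδ, ContinuousMulEquiv.apply_symm_apply]
  by_cases hadm : ∀ w, w ∈ S → w ∈ splitChartPlaces L α
  · -- the partner chart point on the `α`-atlas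
    have hcorr₀ := corresponds_gprimeTorus_archCongr_symm_gprimeTorus (L := L) (T := T) (Φ := Φ) (hΦ := hΦ) (α := α) hadm c
    have hcorrγ : Corresponds (UnitaryGroup.conjMixed (↥(maximalRealSubfield L)) L (IsCMField.complexConj L))
        (UnitaryGroup.archFormOf L 3 (Matrix.diagonal α))
        (UnitaryGroup.archFormOf L 3 (Matrix.of fun i j : Fin 3 => if i.val + j.val + 1 = 3 then (1 : L) else 0))
        (gprimeTorus L α S c) γ := IsConj.trans hcorr₀ hstγδ.symm
    -- the frames identity at the partner chart points
    have hframes := archStableOrbitalIntegral_gprimeTorus_eq_of_sum_chartOrbG_eq L α ν' S m' t' hd' hW' hC'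
      (Measure.map Φ ν) (m.transport Φ.toMulEquiv Φ.continuous Φ.symm.continuous) tβ hdβ hWβ hCβ t hd₂ T Φ hΦ hC'G htβ
      hα hherm hhermβ hadm hc a' f (sum_chartOrbG_eq_of_stableSumG_eq L α ν' (Measure.map Φ ν) _ hadm hc (hEq S c hc))
    refine ⟨fun γ' hcorr => ?_, fun hno => absurd hcorrγ (hno _)⟩
    have hst' : IsStablyConj (UnitaryGroup.conjMixed (↥(maximalRealSubfield L)) L (IsCMField.complexConj L))
        (UnitaryGroup.archFormOf L 3 (Matrix.diagonal α)) γ' (gprimeTorus L α S c) := Corresponds.isStablyConj_left hcorr hcorrγ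
    show archStableOrbitalIntegral L 3 _ m (f ∘ Φ) γ = archStableOrbitalIntegral L 3 _ m' a' γ'
    rw [hLHS, hframes, archStableOrbitalIntegral_eq_of_isStablyConj L 3 _ m' a' hst']
  · -- a chart meeting a definite place of `α`: no partner, and the chart sum vanishes
    push Not at hadm
    obtain ⟨w, hwS, hwα⟩ := hadm
    have hx : c w 0 ≠ 0 := ((ArchCartan.mem_regG_iff S c).1 hc).2 w hwS
    have hno : ∀ γ' : ↥(arch (↥(maximalRealSubfield L)) L (IsCMField.complexConj L) 3 (Matrix.diagonal α)),
        ¬ Corresponds (UnitaryGroup.conjMixed (↥(maximalRealSubfield L)) L (IsCMField.complexConj L))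
          (UnitaryGroup.archFormOf L 3 (Matrix.diagonal α))
          (UnitaryGroup.archFormOf L 3 (Matrix.of fun i j : Fin 3 => if i.val + j.val + 1 = 3 then (1 : L) else 0)) γ' γ := by
      intro γ' h
      exact forall_not_corresponds_archCongr_symm_gprimeTorus (L := L) (T := T) (Φ := Φ) (hΦ := hΦ) hα (hreal w) hwS hwα hx γ'
        (IsConj.trans h hstγδ)
    refine ⟨fun γ' hcorr => absurd hcorr (hno γ'), fun _ => ?_⟩
    -- the chart sum of `f` on `S` vanishes: the `α`-family is the zero label there
    have hzero : ∑ ρ ∈ partnerPerms S, chartOrbG L ![(2 : L)⁻¹, 1, -(2 : L)⁻¹] (Measure.map Φ ν) S f (slotPerm ρ c) = 0 := by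
      have h := hEq S c hc
      have hα0 : orbFamGExt L α ν' a' S = fun _ => 0 :=
        orbFamGExt_of_not_admissible L α ν' a' S fun h' => hwα (h' w hwS)
      rw [stableSumG_orbFamGExt_eq_archRG_mul_sum L _ (Measure.map Φ ν) (fun w _ => mem_splitChartPlaces_quasiSplitWeights L w) hc f] at h
      have hR : stableSumG (fun S' c' => (∏ _w ∈ Finset.univ.filter (fun w => ¬ IsIndefiniteAt (slotSign L α) w), (3 : ℂ)⁻¹) *
          orbFamGExt L α ν' a' S' c') S c = 0 := by
        rw [stableSumG_apply]
        exact Finset.sum_eq_zero fun ρ _ => by rw [hα0]; simp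
      rw [hR] at h
      exact (mul_eq_zero.1 h).resolve_left (archRG_ne_zero_of_mem_regG hc)
    show archStableOrbitalIntegral L 3 _ m (f ∘ Φ) γ = 0
    rw [hLHS, stableOrbitalIntegralRel_gprimeTorus_eq_inv_boxMass_mul_sum L _ (Measure.map Φ ν) S
      (m.transport Φ.toMulEquiv Φ.continuous Φ.symm.continuous) tβ hdβ hWβ hCβ hβ hhermβ
      (fun w _ => mem_splitChartPlaces_quasiSplitWeights L w) hc f, hzero, mul_zero, mul_zero]

end ReadInner

end Literature.NumberTheory.Rogawski1990

end
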